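import Summits.Ventures.PercRepro.GenQProfileFacts

/-!
# PercRepro — the solid-type sets of a rank-`q` set, counted by their solids (night-4, gen 4)

The type-`5` LP of record of the `(8, 6)` cell (sheet §55; the minimal sound rows) refines the cyclic-rank profile by
PER-SOLID variables: for a rank-`4` flat `F` of `M` (a SOLID) let `betaF M G F q` be the number of `(q − 4)`-subsets
`K ⊆ G ∖ F` with `rk(K ∪ (F ∩ G)) = q` (the bases of the contraction by `F` inside `G`), `N4 M G s` the number of
solids with `s` points of `G` and `B4 M G q s = Σ_{|F ∩ G| = s} betaF`.  This file is the Lean side of the two solid rows: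

* (S1s≤) `card_Pc_sub_four_le`: the solid-type sets of level `k` (`m(S) = q − 4`: cyclic part `Z` of rank `4`, inside
  the solid `cl Z`, with `d − k + 4` points) number at most `Σ_s C(s, d − k + 4)·B4 s` — the map `S ↦ (Z, K)` into the
  pairs (a `(d − k + 4)`-subset of `F ∩ G`, a base of the contraction) is injective (`S = Z ∪ K`);
* (S5s) `B4_le`: `B4 s ≤ C(|G| − s, q − 4)·N4 s`.

The closure of the cyclic part is night-2's `lineOf` (the same finset, whatever the rank); `lineOf_mem_flatsQ_four` puts it
in `flatsQ M 4` for the solid-type sets.  Imports `GenQProfileFacts` (hence night-2's profile and line facts).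
-/
namespace PercRepro.Night4

open Finset ThmH SixFour GenQ PerFlat Star

variable {α : Type*} [DecidableEq α] {M : Matroid α} [M.Finite]

/-! ## The solids and their contractions -/

/-- The bases of the contraction by the solid `F` inside `G`: `#{K ⊆ G ∖ F : |K| = q − 4, rk(K ∪ (F ∩ G)) = q}`. -/
noncomputable def betaF (M : Matroid α) [M.Finite] (G F : Finset α) (q : ℕ) : ℕ :=
  (((G \ F).powersetCard (q - 4)).filter
    (fun K : Finset α => M.eRk ((K ∪ (F ∩ G) : Finset α) : Set α) = (q : ℕ∞))).card

/-- `betaF ≤ C(|G ∖ F|, q − 4)`. -/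
theorem betaF_le (G F : Finset α) (q : ℕ) : betaF M G F q ≤ (G \ F).card.choose (q - 4) := by
  unfold betaF
  exact (Finset.card_filter_le _ _).trans (le_of_eq (Finset.card_powersetCard _ _))

/-- `N4 s = #{F ∈ flatsQ M 4 : |F ∩ G| = s}`: the solids with `s` points of `G`. -/
noncomputable def N4 (M : Matroid α) [M.Finite] (G : Finset α) (s : ℕ) : ℕ :=
  ((flatsQ M 4).filter (fun F : Finset α => (F ∩ G).card = s)).card

/-- `B4 s = Σ_{F ∈ flatsQ M 4, |F ∩ G| = s} betaF`. -/
noncomputable def B4 (M : Matroid α) [M.Finite] (G : Finset α) (q s : ℕ) : ℕ :=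
  ∑ F ∈ (flatsQ M 4).filter (fun F : Finset α => (F ∩ G).card = s), betaF M G F q

/-- A sum over the solids of `f(|F ∩ G|)·betaF` is `Σ_s f(s)·B4 s` (`s ≤ |G|`). -/
theorem sum_solids_mul_betaF_eq (G : Finset α) (q : ℕ) (f : ℕ → ℕ) :
    ∑ F ∈ flatsQ M 4, f (F ∩ G).card * betaF M G F q =
      ∑ s ∈ Finset.range (G.card + 1), f s * B4 M G q s := by
  rw [← Finset.sum_fiberwise_of_maps_to (s := flatsQ M 4) (t := Finset.range (G.card + 1))
    (g := fun F : Finset α => (F ∩ G).card) (fun F _ => Finset.mem_coe.2 (Finset.mem_range.2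
      (Nat.lt_succ_of_le (Finset.card_le_card Finset.inter_subset_right))))]
  apply Finset.sum_congr rfl
  intro s _
  unfold B4
  rw [Finset.mul_sum]
  apply Finset.sum_congr rfl
  intro F hF
  rw [(Finset.mem_filter.1 hF).2]

/-- **(S5s)** `B4 s ≤ C(|G| − s, q − 4)·N4 s`. -/
theorem B4_le (G : Finset α) (q s : ℕ) : B4 M G q s ≤ (G.card - s).choose (q - 4) * N4 M G s := by
  unfold B4 N4
  rw [Finset.card_eq_sum_ones ((flatsQ M 4).filter (fun F : Finset α => (F ∩ G).card = s)), Finset.mul_sum]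
  apply Finset.sum_le_sum
  intro F hF
  have hl := (Finset.mem_filter.1 hF).2
  have h := betaF_le (M := M) G F q
  have hsd : (G \ F).card = G.card - (F ∩ G).card := by
    have h2 := Finset.card_sdiff_add_card_inter G F
    rw [Finset.inter_comm] at h2
    omega
  rw [hsd, hl] at h
  rw [mul_one]
  exact h

/-! ## The solid of a solid-type set -/

/-- For `S ∈ Pc k (q − 4)` (`q ≥ 4`): the cyclic part has rank `4`, so its closure `lineOf S` is a solid of `M`. -/
theorem lineOf_mem_flatsQ_four {G S : Finset α} {q k : ℕ} (hG : G ⊆ gr M) (hq : 4 ≤ q)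
    (hS : S ∈ Pc M G q k (q - 4)) : lineOf M S ∈ flatsQ M 4 := by
  have hS' := mem_Pc.1 hS
  have hr := eRk_sdiff_coloopsOf_add_mTr hG hS'.1
  rw [hS'.2.2] at hr
  have hr4 : M.eRk ((S \ coloopsOf M S : Finset α) : Set α) = ((4 : ℕ) : ℕ∞) := by
    obtain ⟨a, ha⟩ := exists_eRk_eq_nat (M := M) (S \ coloopsOf M S)
    rw [ha] at hr ⊢
    have h' : a + (q - 4) = q := by exact_mod_cast hr
    have : a = 4 := by omega
    rw [this]
  rw [mem_flatsQ]
  refine ⟨?_, ?_, ?_⟩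
  · intro x hx
    unfold lineOf clF at hx
    rw [Set.Finite.mem_toFinset] at hx
    rw [← Finset.mem_coe, coe_gr M]
    exact M.closure_subset_ground _ hx
  · unfold lineOf
    rw [coe_clF]
    exact Matroid.isFlat_closure _
  · unfold lineOf
    rw [coe_clF, Matroid.eRk_closure_eq, hr4]

/-- **(S1s≤)** The solid-type sets at level `k` whose solid is `F` inject into the pairs `(Z, K)`:
`#{S ∈ Pc k (q−4) : lineOf S = F} ≤ C(|F ∩ G|, d − k + 4)·betaF M G F q`. -/
theorem card_filter_lineOf_le {G : Finset α} {q d k : ℕ} (hG : G ⊆ gr M)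
    (hrG : M.eRk (G : Set α) = (q : ℕ∞)) (hq : 4 ≤ q) (hcard : G.card = q + d) (hk : k < d)
    {F : Finset α} :
    ((Pc M G q k (q - 4)).filter (fun S : Finset α => lineOf M S = F)).card ≤
      (F ∩ G).card.choose (d - k + 4) * betaF M G F q := by
  unfold betaF
  rw [← Finset.card_powersetCard, ← Finset.card_product]
  apply Finset.card_le_card_of_injOn (fun S => (S \ coloopsOf M S, coloopsOf M S))
  · intro S hS
    rw [Finset.mem_coe, Finset.mem_filter] at hS
    obtain ⟨hSc, hline⟩ := hS
    have hS' := mem_Pc.1 hSc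
    have hSG := (mem_Rq.1 hS'.1).1
    have hsd := Finset.card_sdiff_of_subset hSG
    have hle := Finset.card_le_card hSG
    rw [hS'.2.1] at hsd
    rw [Finset.mem_coe, Finset.mem_product, Finset.mem_powersetCard, Finset.mem_filter, Finset.mem_powersetCard]
    refine ⟨⟨hline ▸ sdiff_coloopsOf_subset_lineOf_inter hG hSc, ?_⟩, ⟨hline ▸ coloopsOf_subset_sdiff_lineOf hSc, hS'.2.2⟩, ?_⟩
    · rw [card_sdiff_coloopsOf, hS'.2.2]
      omega
    · apply le_antisymm
      · rw [← hrG]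
        apply M.eRk_mono
        rw [Finset.coe_union]
        refine Set.union_subset ?_ ?_
        · exact (Finset.coe_subset.2 (coloopsOf_subset S)).trans (Finset.coe_subset.2 hSG)
        · exact Finset.coe_subset.2 Finset.inter_subset_right
      · rw [← (mem_Rq.1 hS'.1).2]
        apply M.eRk_mono
        rw [Finset.coe_union]
        intro y hy
        have hy' := Finset.mem_coe.1 hy
        by_cases hyK : y ∈ coloopsOf M S
        · exact Or.inl (Finset.mem_coe.2 hyK)
        · exact Or.inr (Finset.mem_coe.2 (hline ▸ sdiff_coloopsOf_subset_lineOf_inter hG hSc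
            (Finset.mem_sdiff.2 ⟨hy', hyK⟩)))
  · intro S₁ hS₁ S₂ hS₂ heq
    simp only [Prod.mk.injEq] at heq
    have h1 : S₁ = (S₁ \ coloopsOf M S₁) ∪ coloopsOf M S₁ := (Finset.sdiff_union_of_subset (coloopsOf_subset S₁)).symm
    have h2 : S₂ = (S₂ \ coloopsOf M S₂) ∪ coloopsOf M S₂ := (Finset.sdiff_union_of_subset (coloopsOf_subset S₂)).symm
    rw [h1, h2, heq.1, heq.2]

/-- **(S1s≤), summed over the solids**: `#Pc k (q − 4) ≤ Σ_s C(s, d − k + 4)·B4 s`. -/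
theorem card_Pc_sub_four_le {G : Finset α} {q d k : ℕ} (hG : G ⊆ gr M)
    (hrG : M.eRk (G : Set α) = (q : ℕ∞)) (hq : 4 ≤ q) (hcard : G.card = q + d) (hk : k < d) :
    (Pc M G q k (q - 4)).card ≤
      ∑ s ∈ Finset.range (G.card + 1), s.choose (d - k + 4) * B4 M G q s := by
  rw [← sum_solids_mul_betaF_eq]
  rw [Finset.card_eq_sum_card_fiberwise (s := Pc M G q k (q - 4)) (t := flatsQ M 4)
    (f := fun S => lineOf M S) (fun S hS => Finset.mem_coe.2 (lineOf_mem_flatsQ_four hG hq hS))]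
  apply Finset.sum_le_sum
  intro F _
  exact card_filter_lineOf_le hG hrG hq hcard hk

end PercRepro.Night4
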